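import Summits.BirchSwinnertonDyer.BirchSwinnertonDyer.Theorems.ManinLocalTwoThreeThreeTorsionTangentSlope
import HarnessLib

/-!
# `3`-torsion points of the intrinsic model are `3`-integral: the blindness criteria with NO point hypotheses

Summit `BirchSwinnertonDyer`, route `ManinLocalTwoThree` (cell bsd-f2-manin), crux C3 `ManinPrimeToThreeAtNine` (stmt-BirchSwinnertonDyer-22968),
stubs NB₃ / (BL).  Local Nagell–Lutz at `3` for the short model `E♮ : y² = x³ + a₄♮x + a₆♮` with `3`-integral coefficients: a rational
root `X₁` of `Ψ₃ = 3x⁴ + 6a₄x² + 12a₆x − a₄²` is `3`-integral (if `‖X₁‖₃ ≥ 3` the term `x⁴` dominates `2a₄x², 4a₆x, a₄²/3`), hence so is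
`Y₁`.  Consequently the lead's blindness criteria need no hypothesis on the point:

* `norm_le_one_of_quartic_root_three` — the domination lemma (`‖a‖, ‖b‖ ≤ 1`, `‖d‖ ≤ 3`);
* `norm_le_one_of_isShortThreeTorsion` — `‖X₁‖₃ ≤ 1 ∧ ‖Y₁‖₃ ≤ 1` for `IsShortThreeTorsion W 1 X₁ Y₁` when `a₄♮, a₆♮` are `3`-integral;
* `not_threeBlind_of_congruence_of_nine_dvd` — at a datum of level `9 ∣ N`: `Y₁ ≢ α/3 (mod 3)` ⟹ `T` not `3`-blind;
* `threeBlind_iff_unitCube_of_nine_dvd` — at a datum of level `9 ∣ N`: `ThreeBlind W X₁ Y₁ ↔ ∃ U ∈ ℤ₃⟦q⟧ˣ, U³ ↦ Θ♮_T`, for EVERY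
  rational point of order `3` of `E♮` (NB₃'s predicate made explicit and `Frac`-free).

Nothing about BSD, Manin's conjecture or C3 is proved. [cite: SilvermanAEC2009, VII.3.4 (shape: torsion points are integral at unramified `p`)]
-/

set_option autoImplicit false
set_option linter.dupNamespace false

noncomputable section

open scoped Classical
open PowerSeries WeierstrassCurve Literature.NumberTheory.EllipticCurves Literature.NumberTheory.EllipticCurves.ModularForms
open Summit.BirchSwinnertonDyer.Rank1Residual.ManinAdditive
open Summit.BirchSwinnertonDyer.Rank1Residual.ManinAdditive.CuspidalKummer
open Summit.BirchSwinnertonDyer.Rank1Residual.ManinAdditive.CuspidalKummerThree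

namespace Summit.BirchSwinnertonDyer.BirchSwinnertonDyer.Theorems.ManinLocalTwoThree

/-- In `ℚ₃`: `‖x‖ > 1 ⟹ ‖x‖ ≥ 3` (the value group is `3^ℤ`). [folklore] -/
theorem three_le_norm_of_one_lt_norm_padicThree {x : ℚ_[3]} (hx : 1 < ‖x‖) : 3 ≤ ‖x‖ := by
  have hx0 : x ≠ 0 := by intro h; rw [h, norm_zero] at hx; norm_num at hx
  have hn : ‖x‖ = (3 : ℝ) ^ (-x.valuation) := by exact_mod_cast Padic.norm_eq_zpow_neg_valuation hx0
  rw [hn] at hx ⊢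
  have hv : (1 : ℤ) ≤ -x.valuation := by
    by_contra hlt
    have h' : (3 : ℝ) ^ (-x.valuation) ≤ (3 : ℝ) ^ (0 : ℤ) := zpow_le_zpow_right₀ (by norm_num) (by omega)
    rw [zpow_zero] at h'
    linarith
  have h' : (3 : ℝ) ^ (1 : ℤ) ≤ (3 : ℝ) ^ (-x.valuation) := zpow_le_zpow_right₀ (by norm_num) hv
  rwa [zpow_one] at h'

/-- **Domination lemma**: a `ℚ₃`-root of `x⁴ + a x² + b x + d` with `‖a‖, ‖b‖ ≤ 1`, `‖d‖ ≤ 3` is `3`-integral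
(if `‖x‖ ≥ 3` then `‖x⁴‖ > ‖a x² + b x + d‖`). [folklore] -/
theorem norm_le_one_of_quartic_root_three {x a b d : ℚ_[3]} (ha : ‖a‖ ≤ 1) (hb : ‖b‖ ≤ 1) (hd : ‖d‖ ≤ 3)
    (h : x ^ 4 + a * x ^ 2 + b * x + d = 0) : ‖x‖ ≤ 1 := by
  by_contra hlt
  rw [not_le] at hlt
  have h3 := three_le_norm_of_one_lt_norm_padicThree hlt
  have hx4 : x ^ 4 = -(a * x ^ 2 + b * x + d) := by linear_combination h
  have hsq : ‖x‖ ≤ ‖x‖ ^ 2 := by nlinarith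
  have hbound : ‖x‖ ^ 4 ≤ ‖x‖ ^ 2 := by
    calc ‖x‖ ^ 4 = ‖x ^ 4‖ := (norm_pow x 4).symm
      _ = ‖a * x ^ 2 + b * x + d‖ := by rw [hx4, norm_neg]
      _ ≤ max ‖a * x ^ 2 + b * x‖ ‖d‖ := Padic.nonarchimedean _ _
      _ ≤ max (max ‖a * x ^ 2‖ ‖b * x‖) ‖d‖ := max_le_max (Padic.nonarchimedean _ _) le_rfl
      _ ≤ max (max (‖x‖ ^ 2) ‖x‖) 3 := by
          refine max_le_max (max_le_max ?_ ?_) hd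
          · rw [norm_mul, norm_pow]; exact mul_le_of_le_one_left (by positivity) ha
          · rw [norm_mul]; exact mul_le_of_le_one_left (norm_nonneg _) hb
      _ = ‖x‖ ^ 2 := by rw [max_eq_left hsq, max_eq_left (le_trans h3 hsq)]
  nlinarith

/-- **`3`-torsion points of `E♮` are `3`-integral**: with `a₄♮, a₆♮` `3`-integral and `IsShortThreeTorsion W 1 X₁ Y₁`,
`‖X₁‖₃ ≤ 1` and `‖Y₁‖₃ ≤ 1` (`Ψ₃(X₁)/3 = X₁⁴ + 2a₄X₁² + 4a₆X₁ − a₄²/3 = 0`, then the curve equation).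
[cite: SilvermanAEC2009, VII.3.4] -/
theorem norm_le_one_of_isShortThreeTorsion (W : WeierstrassCurve ℚ)
    (hA : ‖(((shortModel W 1).a₄ : ℚ) : ℚ_[3])‖ ≤ 1) (hB : ‖(((shortModel W 1).a₆ : ℚ) : ℚ_[3])‖ ≤ 1)
    {X₁ Y₁ : ℚ} (hT : IsShortThreeTorsion W 1 X₁ Y₁) :
    ‖((X₁ : ℚ) : ℚ_[3])‖ ≤ 1 ∧ ‖((Y₁ : ℚ) : ℚ_[3])‖ ≤ 1 := by
  set A := (shortModel W 1).a₄ with hAdef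
  set B := (shortModel W 1).a₆ with hBdef
  have heq := equation_of_isShortThreeTorsion hT
  have hΨ := (isRoot_Ψ₃_shortModel_iff W 1 X₁).mp hT.2
  rw [← hAdef, ← hBdef] at heq hΨ
  have hn2 : ‖(2 : ℚ_[3])‖ ≤ 1 := by
    have := Padic.norm_int_le_one (p := 3) 2; exact_mod_cast this
  have hn4 : ‖(4 : ℚ_[3])‖ ≤ 1 := by
    have := Padic.norm_int_le_one (p := 3) 4; exact_mod_cast this
  have hn3 : ‖(3 : ℚ_[3])⁻¹‖ = 3 := by
    have := Padic.norm_p (p := 3)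
    rw [norm_inv]; have e : ‖(3 : ℚ_[3])‖ = 3⁻¹ := by exact_mod_cast this
    rw [e, inv_inv]
  have hX : ‖((X₁ : ℚ) : ℚ_[3])‖ ≤ 1 := by
    refine norm_le_one_of_quartic_root_three (a := 2 * ((A : ℚ) : ℚ_[3])) (b := 4 * ((B : ℚ) : ℚ_[3]))
      (d := -(((A : ℚ) : ℚ_[3]) ^ 2 * (3 : ℚ_[3])⁻¹)) ?_ ?_ ?_ ?_
    · rw [norm_mul]; exact mul_le_one₀ hn2 (norm_nonneg _) hA
    · rw [norm_mul]; exact mul_le_one₀ hn4 (norm_nonneg _) hB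
    · rw [norm_neg, norm_mul, norm_pow, hn3]
      have : ‖((A : ℚ) : ℚ_[3])‖ ^ 2 ≤ 1 := pow_le_one₀ (norm_nonneg _) hA
      linarith
    · have h := congrArg (fun q : ℚ => (q : ℚ_[3])) hΨ
      push_cast at h
      have h3 : (3 : ℚ_[3]) ≠ 0 := by norm_num
      field_simp
      linear_combination h
  refine ⟨hX, ?_⟩
  have hY2 : ‖((Y₁ : ℚ) : ℚ_[3])‖ ^ 2 ≤ 1 := by
    have h := congrArg (fun q : ℚ => (q : ℚ_[3])) heq
    push_cast at h
    rw [← norm_pow, h]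
    calc ‖((X₁ : ℚ) : ℚ_[3]) ^ 3 + ((A : ℚ) : ℚ_[3]) * ((X₁ : ℚ) : ℚ_[3]) + ((B : ℚ) : ℚ_[3])‖
        ≤ max ‖((X₁ : ℚ) : ℚ_[3]) ^ 3 + ((A : ℚ) : ℚ_[3]) * ((X₁ : ℚ) : ℚ_[3])‖ ‖((B : ℚ) : ℚ_[3])‖ :=
          Padic.nonarchimedean _ _
      _ ≤ max (max ‖((X₁ : ℚ) : ℚ_[3]) ^ 3‖ ‖((A : ℚ) : ℚ_[3]) * ((X₁ : ℚ) : ℚ_[3])‖) ‖((B : ℚ) : ℚ_[3])‖ :=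
          max_le_max (Padic.nonarchimedean _ _) le_rfl
      _ ≤ max (max 1 1) 1 := by
          refine max_le_max (max_le_max ?_ ?_) hB
          · rw [norm_pow]; exact pow_le_one₀ (norm_nonneg _) hX
          · rw [norm_mul]; exact mul_le_one₀ hA (norm_nonneg _) hX
      _ = 1 := by norm_num
  nlinarith [norm_nonneg ((Y₁ : ℚ) : ℚ_[3])]

/-- At a datum of level `9 ∣ N`, `a₄♮, a₆♮` are `3`-integral (p3's `exists_padicInt_shortModel_three`). [folklore] -/
theorem norm_shortModel_le_one_of_nine_dvd (W : WeierstrassCurve ℚ) [W.IsElliptic] [W.IsGloballyMinimal] {N : ℕ} [NeZero N]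
    (D : ModularParametrizationData W N) (h9 : 9 ∣ N) :
    ‖(((shortModel W 1).a₄ : ℚ) : ℚ_[3])‖ ≤ 1 ∧ ‖(((shortModel W 1).a₆ : ℚ) : ℚ_[3])‖ ≤ 1 := by
  obtain ⟨ha3, hN3⟩ := lFunction_three_eq_zero_of_nine_dvd W D.isNewformOf h9
  obtain ⟨hΔ3, hc₄3⟩ := three_dvd_Δ_and_c₄_of_hasAdditiveReductionAt W
    (hasAdditiveReductionAt_three_of_lFunction_three_eq_zero W ha3 hN3)
  obtain ⟨V, -, -, -, hVE, -, -, -⟩ := exists_padicInt_shortModel_three W hΔ3 hc₄3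
  have hrat : ∀ q : ℚ, algebraMap ℚ ℚ_[3] q = (q : ℚ_[3]) := fun q => by rw [eq_ratCast]
  constructor
  · have h := congrArg WeierstrassCurve.a₄ hVE
    rw [map_a₄, map_a₄, hrat] at h
    rw [← h]; exact PadicInt.norm_le_one _
  · have h := congrArg WeierstrassCurve.a₆ hVE
    rw [map_a₆, map_a₆, hrat] at h
    rw [← h]; exact PadicInt.norm_le_one _

/-- **Non-blindness by one congruence** (no point hypotheses): at a datum of level `9 ∣ N`, a rational point `T = (X₁, Y₁)` of
order `3` of `E♮` with `Y₁ ≢ α/3 (mod 3)` is not `3`-blind. [folklore] -/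
theorem not_threeBlind_of_congruence_of_nine_dvd (W : WeierstrassCurve ℚ) [W.IsElliptic] [W.IsGloballyMinimal]
    {N : ℕ} [NeZero N] (D : ModularParametrizationData W N) (h9 : 9 ∣ N) {X₁ Y₁ : ℚ} (hT : IsShortThreeTorsion W 1 X₁ Y₁)
    (hcert : 1 < ‖(((Y₁ - tangentSlope W 1 X₁ Y₁ / 3) / 3 : ℚ) : ℚ_[3])‖) : ¬ ThreeBlind W X₁ Y₁ := by
  obtain ⟨hA, hB⟩ := norm_shortModel_le_one_of_nine_dvd W D h9
  obtain ⟨hX, hY⟩ := norm_le_one_of_isShortThreeTorsion W hA hB hT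
  exact not_threeBlind_of_residue_certificate W hA hB hT hX hY hcert

/-- **NB₃'s predicate, explicit and `Frac`-free** (no point hypotheses): at a datum of level `9 ∣ N`, a rational point `T` of order `3`
of `E♮` is `3`-blind iff `Θ♮_T` is the image of the cube of a unit of `ℤ₃⟦q⟧`. [cite: Washington1997, Thm. 7.3] -/
theorem threeBlind_iff_unitCube_of_nine_dvd (W : WeierstrassCurve ℚ) [W.IsElliptic] [W.IsGloballyMinimal]
    {N : ℕ} [NeZero N] (D : ModularParametrizationData W N) (h9 : 9 ∣ N) {X₁ Y₁ : ℚ} (hT : IsShortThreeTorsion W 1 X₁ Y₁) :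
    ThreeBlind W X₁ Y₁ ↔ ∃ U : (ℤ_[3])⟦X⟧, IsUnit U ∧
      (U ^ 3).map (PadicInt.Coe.ringHom (p := 3)) = (kummerCubeSeries W 1 X₁ Y₁ X).map (Rat.castHom ℚ_[3]) := by
  obtain ⟨hA, hB⟩ := norm_shortModel_le_one_of_nine_dvd W D h9
  obtain ⟨hX, hY⟩ := norm_le_one_of_isShortThreeTorsion W hA hB hT
  exact threeBlind_iff_exists_isUnit_cube_map_of_isShortThreeTorsion W hA hB hT hX hY

end Summit.BirchSwinnertonDyer.BirchSwinnertonDyer.Theorems.ManinLocalTwoThree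

end
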